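import Literature.MathematicalPhysics.QuantumFieldTheory.Balaban1983to89.B9SectBL2StepAtLettersV2Right
import Literature.MathematicalPhysics.QuantumFieldTheory.Balaban1983to89.B9Ineq363L2Mixed

/-!
# `Balaban1983to89.B9SectBL2StepAtLettersV2Mixed` — [B9] Sect. B, the MIXED `L²` member (3.46)₄ of Theorem 3.1 FOR G′(U′U) (`‖h∇_UG′(U′U)∇*_Uλ‖`),
# PINNED AT THE LETTERS AND KERNEL-FREE: ★ `l2mixedEntries_ext_of_l2Frame₂` and ★★ `stepL2nPos_four_of_l2Frame₂ : L2Frame₂ … → (readL2_2) →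
# (readL2_4) → (writeL2_4) → StepL2nPos d c35 geo bg Gp GA Cinv Gp 4` — the fourth of the fifteen member-steps `B9SectBStepFrameV2.SectBFrame₂`
# displays (sequel of `B9SectBL2StepAtLettersV2` (members 0, 1) and `…V2Right` (member 2))

T. Bałaban, *Propagators for lattice gauge theories in a background field*, Commun. Math. Phys. **99** (1985) 389–434
[`Balaban1985BackgroundPropagators`, "B9"]; [4] = T. Bałaban, *Propagators and renormalization transformations for lattice gauge theories. II*,
Commun. Math. Phys. **96** (1984) 223–250 [`Balaban1984PropagatorsII`].

statement-level skeleton of published theorems with citation tags; proofs where landed; nothing here is a claim about the Yang–Mills mass gap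

THE PRINTED LOCUS (verbatim).  Theorem 3.1 (3.46) p. 398 (fourth quantity `‖h∇_UG′(U)∇*_Uλ‖`, prefactor `1`); Theorem 3.4 p. 400 + p. 403 l. 1–9: *"applying
Theorem 3.1 for G′(U), the bound (3.63), the representation (3.64) and Lemma 2.1 of [4] we can prove all the statements (3.42)–(3.47) of Theorem 3.1 for
the operator G′(U′U), of course with different constants"*.

WHAT IS IN THE FILE (theorems only; 0 sorry; standard axioms).  ★ `l2mixedEntries_ext_of_l2Frame₂` (for every input (B₀, δ₀): `a₁`, `B` BEFORE the member;
at every admissible U, U′ and every PAIR of concrete difference letters: `∇_kG′(U′U)∇♯_l ≺₂ B·e^{−rateR(δr)d}`); ★★ `stepL2nPos_four_of_l2Frame₂`.  ROUTE: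
the right entries of `B9SectBL2StepAtLettersV2Right.l2rightEntries_ext_of_l2Frame₂` (their `a₁` carries the only smallness); r06's `thm34_Gp_uniform` (R1)
for the inverse identities (`gop_eq`; (3.65)₁ by `eq365_first_of_inverse`); the left composite at the letter ∇ `B9Ineq363L2Mixed.hasL2Majorant_dgp_vPrime`
(from `L2Frame₂.readL2`'s member 1 and `readL2_4`); ONE composition `hasL2Majorant_mixedEntry_gpExt`.

THE EXTRA HYPOTHESES (what an instance owes beyond `L2Frame₂`; all pure unfolding of its own `KernelFamily.l2` against `HasL2Majorant` of its letters):
`readL2_2` (as in `…V2Right`), `readL2_4` — `∇_kG′(U)∇♯_l ≺₂ cL·B₀·e^{−δd}` for every pair `(k, l)` —, `writeL2_4` — `∇_kG′(U′U)∇♯_l ≺₂ B·e^{−ρd}` for every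
pair ⇒ the member n = 4 of the family at U′U with `(wL B ρ, wLδ ρ)`.  WHICH printed quantity the family's member 4 is stays the instance's choice (the
tree's two lineages differ on members 3∕4∕5, cf. the cell's LOCATED notes); the frame only produces the mixed majorants.

HONEST SCOPE.  Hypothesis structure + bookkeeping; Theorem 3.1 at U is the INPUT; nothing of [B9] asserted for Bałaban's propagators; `L2Frame₂` NOT shown
inhabited; count-neutral; NOT a node discharge; nothing continuum ∕ OS ∕ mass-gap ∕ Clay.  Cell `pub-ymgap` (HUMAN RULING D-0062), Track A node N06 [B9],
N06-ASSIGNMENT row 13, seat `pub-ymgap-dag-n06-c` (g4), 2026-08-27.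
-/

noncomputable section

open scoped BigOperators

namespace Literature.MathematicalPhysics.QuantumFieldTheory.Balaban1983to89.B9SectBL2StepAtLettersV2Mixed

open Literature.MathematicalPhysics.QuantumFieldTheory.Balaban1983to89
open Literature.MathematicalPhysics.QuantumFieldTheory.Balaban1983to89.B6RandomWalk (HasMajorant Triangle254 Ineq261)
open Literature.MathematicalPhysics.QuantumFieldTheory.Balaban1983to89.B6RandomWalkL2 (l2n HasL2Majorant hasL2Majorant_mono)
open Literature.MathematicalPhysics.QuantumFieldTheory.Balaban1983to89.B9Thm34Ext (toB6)
open Literature.MathematicalPhysics.QuantumFieldTheory.Balaban1983to89.B9Ineq347 (ScaleTransfer)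
open Literature.MathematicalPhysics.QuantumFieldTheory.Balaban1983to89.B9Eq352DivFormLetters (conj)
open Literature.MathematicalPhysics.QuantumFieldTheory.Balaban1983to89.B9Eq352GradLetters (diffLetter)
open Literature.MathematicalPhysics.QuantumFieldTheory.Balaban1983to89.B9Eq360Vprime (gPrimeExtEnd)
open Literature.MathematicalPhysics.QuantumFieldTheory.Balaban1983to89.B9Eq360VprimeLetters (vPrimeConc)
open Literature.MathematicalPhysics.QuantumFieldTheory.Balaban1983to89.B9Thm34SectBUniformR1 (thm34_Gp_uniform)
open Literature.MathematicalPhysics.QuantumFieldTheory.Balaban1983to89.B9Thm34GFinal (ineq261_rescale scaleTransfer_rescale)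
open Literature.MathematicalPhysics.QuantumFieldTheory.Balaban1983to89.B9FromB6 (EBlock L2Block)
open Literature.MathematicalPhysics.QuantumFieldTheory.Balaban1983to89.B9SectBStepWhole (StepPos StepL2nPos)
open Literature.MathematicalPhysics.QuantumFieldTheory.Balaban1983to89.B9SectBGpStepAtLettersV2 (GpFrame₂)
open Literature.MathematicalPhysics.QuantumFieldTheory.Balaban1983to89.B9SectBL2StepAtLettersV2 (L2Frame₂ cVL2_le_one)
open Literature.MathematicalPhysics.QuantumFieldTheory.Balaban1983to89.B9Ineq363L2 (cVL2 cVL2_nonneg hasL2Majorant_rate_mono)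
open Literature.MathematicalPhysics.QuantumFieldTheory.Balaban1983to89.B9Ineq363L2Right (eq365_first_of_inverse)
open Literature.MathematicalPhysics.QuantumFieldTheory.Balaban1983to89.B9Ineq363L2Mixed (hasL2Majorant_dgp_vPrime
  hasL2Majorant_mixedEntry_gpExt)
open Literature.MathematicalPhysics.QuantumFieldTheory.Balaban1983to89.B9SectBL2StepAtLettersV2Right (thetaL2R rateR rateR_pos
  l2rightEntries_ext_of_l2Frame₂)

universe u

variable {I : Type} {d : ℕ} {c35 : ℝ} {geo : I → B9.Geometry} {bg : I → B9.Backgrounds}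
  {Gp : ∀ i, B9.KernelFamily (geo i) (bg i)}
  {𝔸 : Type u} [NormedRing 𝔸] [NormedAlgebra ℂ 𝔸] [CompleteSpace 𝔸] {ι : Type} [Fintype ι] [DecidableEq ι]
  {b : Module.Basis ι ℝ 𝔸} {κ : Type} [Fintype κ]
  {S : I → Type} [∀ i, Fintype (S i)] [∀ i, DecidableEq (S i)]
  [∀ i, Fintype (geo i).Site] [∀ i, DecidableEq (geo i).Site] [∀ i, Nonempty (geo i).Site]

/-- ★ **THE MIXED `L²` ENTRIES (3.46)₄ OF G′(U′U) AT THE LETTERS, KERNEL-FREE** — the core of the step below: given, on top of an `L2Frame₂`, the `L²`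
READINGS at U of member 2 (`readL2_2`, per difference letter) and of the mixed member (`readL2_4`: `∇_kG′(U)∇♯_l ≺₂ cL·B₀·e^{−δd}` per PAIR of letters),
for every input (B₀, δ₀) > 0 there are `a₁ > 0`, `B ≧ 0` (before the member) such that at every admissible U, U′ every `∇_kG′(U′U)∇♯_l` carries the
block-ℓ² majorant `B·e^{−ρ″d}`, `ρ″ = rateR δr`.  Proof: the right entries of `B9SectBL2StepAtLettersV2Right.l2rightEntries_ext_of_l2Frame₂` (their `a₁`
carries the only smallness); r06's `thm34_Gp_uniform` (R1) for the inverse identities (`gop_eq`, (3.65)₁ by `eq365_first_of_inverse`); the left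
composite at the letter ∇ `B9Ineq363L2Mixed.hasL2Majorant_dgp_vPrime` (from the readings n = 1, 4 at U); ONE composition
`hasL2Majorant_mixedEntry_gpExt` — no further walk.
[cite: Balaban1985BackgroundPropagators, Thm 3.4 p.400 + (3.60)–(3.65) p.402 + p.403 l.1–9 + Thm 3.1 (3.46) p.398 + p.398 (remarks); Balaban1984PropagatorsII, Lemma 2.1 p.234 + Prop. 2.6 (2.140)–(2.141) p.247] -/
theorem l2mixedEntries_ext_of_l2Frame₂ (F : L2Frame₂ c35 geo bg Gp b κ S)
    (readL2_2 : ∀ i (α₀ : ℝ) (U : (bg i).Cfg) (B₀ δ : ℝ), F.MInv ≤ (geo i).M → 0 < α₀ → (geo i).M * α₀ ≤ F.aInv →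
      (bg i).Reg335 c35 α₀ U → 0 < B₀ → 0 < δ → L2Block (Gp i) B₀ δ U →
      ∀ k : κ ⊕ κ, HasL2Majorant (g := toB6 (geo i) (F.Rr i) (F.Hp i)) (fun p : S i × ι => F.blk i p.1)
        (F.Gop i U * conj b (diffLetter (F.T i) (F.coord i U) ((((geo i).eta : ℂ))⁻¹) k))
        (fun a a' => F.cL * B₀ * (geo i).len a * Real.exp (-(δ * (geo i).dist a a'))))
    (readL2_4 : ∀ i (α₀ : ℝ) (U : (bg i).Cfg) (B₀ δ : ℝ), F.MInv ≤ (geo i).M → 0 < α₀ → (geo i).M * α₀ ≤ F.aInv →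
      (bg i).Reg335 c35 α₀ U → 0 < B₀ → 0 < δ → L2Block (Gp i) B₀ δ U →
      ∀ k l : κ ⊕ κ, HasL2Majorant (g := toB6 (geo i) (F.Rr i) (F.Hp i)) (fun p : S i × ι => F.blk i p.1)
        (conj b (diffLetter (F.T i) (F.coord i U) ((((geo i).eta : ℂ))⁻¹) k) * F.Gop i U *
          conj b (diffLetter (F.T i) (F.coord i U) ((((geo i).eta : ℂ))⁻¹) l))
        (fun a a' => F.cL * B₀ * 1 * Real.exp (-(δ * (geo i).dist a a'))))
    {B₀ δ₀ : ℝ} (hB₀ : 0 < B₀) (hδ₀ : 0 < δ₀) :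
    ∃ a₁ : ℝ, 0 < a₁ ∧ ∃ B : ℝ, 0 ≤ B ∧
      ∀ (i : I) (α₀ : ℝ) (U : (bg i).Cfg), F.Mthr (F.rate δ₀) ≤ (geo i).M → 0 < α₀ → (geo i).M * α₀ ≤ F.aInv →
        (bg i).Reg335 c35 α₀ U → EBlock (Gp i) B₀ δ₀ U → L2Block (Gp i) B₀ δ₀ U →
        ∀ (α₁ : ℝ) (U' : (bg i).Cfg), 0 < α₁ → α₁ ≤ a₁ → (bg i).Cplx337 α₁ U U' →
          ∀ k l : κ ⊕ κ, HasL2Majorant (g := toB6 (geo i) (F.Rr i) (F.Hp i)) (fun p : S i × ι => F.blk i p.1)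
            (conj b (diffLetter (F.T i) (F.coord i U) ((((geo i).eta : ℂ))⁻¹) k) * F.Gop i ((bg i).mul U' U) *
              conj b (diffLetter (F.T i) (F.coord i U) ((((geo i).eta : ℂ))⁻¹) l))
            (fun a a' => B * 1 * Real.exp (-(rateR (F.rate δ₀) * (geo i).dist a a'))) := by
  set δr : ℝ := F.rate δ₀ with hδr_def
  have hδr : 0 < δr := F.rate_pos hδ₀
  have hδrc : δr ≤ F.δcap := F.rate_le_cap δ₀
  have hBG : 0 < F.cR * B₀ := mul_pos F.cR_pos hB₀
  have hBL : 0 < F.cL * B₀ := mul_pos F.cL_pos hB₀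
  have hSb : 0 ≤ ∑ j, ‖b j‖ := Finset.sum_nonneg fun j _ => norm_nonneg _
  have hSb2 : 0 ≤ Real.sqrt (∑ j, ‖b j‖ ^ 2) := Real.sqrt_nonneg _
  -- the right entries (their a₁ carries the smallness of the walk) and r06's clause (inverse identities)
  obtain ⟨aR, haR, B', hB', HR⟩ := l2rightEntries_ext_of_l2Frame₂ F readL2_2 hB₀ hδ₀
  obtain ⟨a₁, ha₁, B'', -, H⟩ := thm34_Gp_uniform b κ (F.d261 δr) δr (F.cR * B₀) F.Cq F.a₀ F.d₀ F.M₂ (F.Λf δr)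
    hBG F.Cq_nonneg F.a₀_nonneg F.M₂_nonneg hδr (fun α hα => F.Λf_one_le _ α hδr hα) F.hrepr
  set Θ : ℝ := thetaL2R F B₀ δr with hΘ
  have hΛ1 : 1 ≤ F.Λf δr (1 / 100) := F.Λf_one_le δr _ hδr (by norm_num)
  have hΛ0 : 0 ≤ F.Λf δr (1 / 100) := zero_le_one.trans hΛ1
  have hc10 : 0 ≤ B6.c1 (F.d261 δr) δr (1 / 100) := B6RandomWalk.c1_nonneg _ _ _
  have hΘ0 : 0 ≤ Θ := by
    rw [hΘ, thetaL2R]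
    have := cVL2_nonneg (d := Fintype.card κ) (nι := Fintype.card ι) (ρu := 1) zero_le_one F.a₀_nonneg F.Cq_nonneg F.M₂_nonneg
      hSb hSb2 (Real.exp_nonneg (δr * F.d₀))
    have := F.cL_pos
    have := F.M₂_nonneg
    positivity
  set a : ℝ := min aR (min a₁ (1 / 4)) with ha_def
  have ha0 : 0 < a := lt_min haR (lt_min ha₁ (by norm_num))
  refine ⟨a, ha0, F.cL * B₀ + Θ * B' * F.Λf δr (1 / 100) * B6.c1 (F.d261 δr) δr (1 / 100), by positivity, ?_⟩
  intro i α₀ U hM0 hα₀ hMa hU hE hL2 α₁ U' hα₁ ha hU' k l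
  have hM : F.MInv ≤ (geo i).M := F.MInv_le_of_Mthr_le hM0
  have haR' : α₁ ≤ aR := ha.trans (min_le_left _ _)
  have ha1 : α₁ ≤ a₁ := ha.trans ((min_le_right _ _).trans (min_le_left _ _))
  have haq : α₁ ≤ 1 / 4 := ha.trans ((min_le_right _ _).trans (min_le_right _ _))
  have hα1 : α₁ ≤ 1 := haq.trans (by norm_num)
  -- the sup letters at U (for r06) and the inverse identities of the extension
  obtain ⟨hΔG, hGΔ⟩ := F.reg_inv i α₀ U hM hα₀ hMa hU
  obtain ⟨h1, h2, h3, -⟩ := F.read342_le i α₀ U hM hα₀ hMa hU hB₀ hδ₀ (F.rate_le δ₀) hE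
  obtain ⟨hkF, hsF, h337s, h337F, h337B, hA, hAτ⟩ := F.cplx i α₁ U U' hα₁ hU'
  obtain ⟨hinv1, hinv2, -, -⟩ := H (F.T i) (F.coord i U) (F.blk i) (F.kQ i U) (F.sQ i U) (F.cfun i) (F.w i U)
    (F.dist_nonneg i) (F.triangle i) (F.dist_self i) (F.dist_comm i) (F.len_pos i) (F.eta_le_len i) (F.eta_pos i)
    (F.h261_of i hδr hδrc hM0) (F.hST_of i hδr hδrc hM0) (F.unitary i U)
    (F.stencilB i) (F.stencilF i) (F.stencil0 i) (F.w_nonneg i U) (F.card_w i U) (F.hkQ i U) (F.hsQ i U) (F.hcfun i)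
    hΔG hGΔ h1 h2 h3 α₁ hα₁.le ha1 (F.expA i U U') (F.kF i U U') (F.sF i U U')
    hkF hsF h337s h337F h337B hA hAτ
  have hG := F.gop_eq i ((bg i).mul U' U) _ _ (F.mul_law i α₁ U U' hα₁ hU') hinv1 hinv2
  -- the L² readings of Theorem 3.1 at U (members 1 and 4), lowered to the call rate δr
  obtain ⟨-, l1⟩ := F.readL2 i α₀ U B₀ δ₀ hM hα₀ hMa hU hB₀ hδ₀ hL2
  have r4 := readL2_4 i α₀ U B₀ δ₀ hM hα₀ hMa hU hB₀ hδ₀ hL2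
  have hw1 : ∀ a : (geo i).Site, 0 ≤ (geo i).len a := fun a => (F.len_pos i a).le
  have l1' := hasL2Majorant_rate_mono (R := F.Rr i) (H := F.Hp i) (fun p : S i × ι => F.blk i p.1) (F.cL * B₀)
    (fun a => (geo i).len a) hBL.le hw1 (F.rate_le δ₀) (F.dist_nonneg i) (l1 k)
  have r4' := fun l => hasL2Majorant_rate_mono (R := F.Rr i) (H := F.Hp i) (fun p : S i × ι => F.blk i p.1) (F.cL * B₀)
    (fun _ => (1 : ℝ)) hBL.le (fun _ => zero_le_one) (F.rate_le δ₀) (F.dist_nonneg i) (r4 k l)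
  have hρδr : 49 / 50 * δr ≤ δr := by nlinarith
  have hρδ₀ : 49 / 50 * δr ≤ δ₀ := hρδr.trans (F.rate_le δ₀)
  have r4ρ := fun l => hasL2Majorant_rate_mono (R := F.Rr i) (H := F.Hp i) (fun p : S i × ι => F.blk i p.1) (F.cL * B₀)
    (fun _ => (1 : ℝ)) hBL.le (fun _ => zero_le_one) hρδ₀ (F.dist_nonneg i) (r4 k l)
  -- Lemma 2.1 at the call rate, exponent 1/100; the scale transfers
  have h261β : Ineq261 (F.d261 δr) (toB6 (geo i) (F.Rr i) (F.Hp i)) δr (1 / 100) :=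
    F.h261_of i hδr hδrc hM0 (1 / 100) (by norm_num) (by norm_num)
  obtain ⟨hT1, -, hT1i, hT2i, -, -⟩ := F.hST_of i hδr hδrc hM0 (1 / 100) (by norm_num)
  -- the left composite at the letter ∇_k, in L², at this member
  have hsmall4 : ∀ y : (geo i).Site, (geo i).eta * (α₁ * ((geo i).len y)⁻¹) ≤ 1 / 4 := by
    intro y
    have hl := F.len_pos i y
    have h1 : (geo i).eta * ((geo i).len y)⁻¹ ≤ 1 := by
      rw [← div_eq_mul_inv]; exact (div_le_one hl).mpr (F.eta_le_len i y)
    calc (geo i).eta * (α₁ * ((geo i).len y)⁻¹) = α₁ * ((geo i).eta * ((geo i).len y)⁻¹) := by ring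
      _ ≤ α₁ * 1 := mul_le_mul_of_nonneg_left h1 hα₁.le
      _ ≤ 1 / 4 := by rw [mul_one]; exact haq
  have hr : 49 / 50 * δr + (1 / 100 + 1 / 100) * δr ≤ δr := by nlinarith
  have hXM := hasL2Majorant_dgp_vPrime (Rr := F.Rr i) (H := F.Hp i) b (F.T i) (F.coord i U) (F.blk i) (F.d261 δr) (F.eta_pos i)
    (F.expA i U U') (F.kQ i U) (F.kF i U U') (F.sQ i U) (F.sF i U U') (F.cfun i) (F.w i U) 1 F.d₀ F.M₂ F.Cq F.a₀
    δr δr (1 / 100) (1 / 100) (49 / 50 * δr) (F.Λf δr (1 / 100)) (F.cL * B₀) α₁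
    hBL.le hα₁.le hΛ0 (by positivity) (by norm_num) (by norm_num) hδr.le hδr.le hr
    (F.dist_nonneg i) (F.triangle i) (F.len_pos i) h261β hT1i hT2i F.M₂_nonneg F.hrepr hsmall4
    (fun μ x => ⟨hA μ x, hAτ μ μ x⟩) (fun μ x => h337s μ μ x) (fun μ x => h337F μ μ x) h337B (fun μ x => F.unitary i U μ x)
    (fun μ x => ⟨F.stencilF i μ x, F.stencilB i μ x⟩) (F.stencil0 i)
    (F.w_nonneg i U) (F.card_w i U) F.Cq_nonneg F.a₀_nonneg (F.hkQ i U) hkF (F.hsQ i U) hsF (F.hcfun i) l1' r4'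
  -- θ_R(α₁) ≤ Θ
  set θ : ℝ := F.cL * B₀ * F.Λf δr (1 / 100) * B6.c1 (F.d261 δr) δr (1 / 100) *
      (cVL2 (Fintype.card κ) (Fintype.card ι) 1 α₁ F.a₀ F.Cq F.M₂ (∑ j, ‖b j‖) (Real.sqrt (∑ j, ‖b j‖ ^ 2))
          (Real.exp (δr * F.d₀)) +
        2 * Fintype.card κ * (2 * (1 : ℝ) ^ 2 * F.M₂ * (∑ j, ‖b j‖) * Real.sqrt ((1 * Fintype.card ι : ℕ) : ℝ) *
          Real.exp (δr * F.d₀))) * α₁ with hθ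
  have hcV0 : 0 ≤ cVL2 (Fintype.card κ) (Fintype.card ι) 1 α₁ F.a₀ F.Cq F.M₂ (∑ j, ‖b j‖) (Real.sqrt (∑ j, ‖b j‖ ^ 2))
      (Real.exp (δr * F.d₀)) :=
    cVL2_nonneg (d := Fintype.card κ) (nι := Fintype.card ι) (ρu := 1) hα₁.le F.a₀_nonneg F.Cq_nonneg F.M₂_nonneg hSb hSb2
      (Real.exp_nonneg (δr * F.d₀))
  have hK0 : 0 ≤ 2 * (Fintype.card κ : ℝ) * (2 * (1 : ℝ) ^ 2 * F.M₂ * (∑ j, ‖b j‖) * Real.sqrt ((1 * Fintype.card ι : ℕ) : ℝ) *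
      Real.exp (δr * F.d₀)) := by have := F.M₂_nonneg; positivity
  have hpre0 : 0 ≤ F.cL * B₀ * F.Λf δr (1 / 100) * B6.c1 (F.d261 δr) δr (1 / 100) := by positivity
  have hθ0 : 0 ≤ θ := by
    rw [hθ]
    exact mul_nonneg (mul_nonneg hpre0 (add_nonneg hcV0 hK0)) hα₁.le
  have hθΘ : θ ≤ Θ := by
    rw [hθ, hΘ, thetaL2R]
    have hcv := cVL2_le_one (dκ := Fintype.card κ) (nι := Fintype.card ι) (E₀ := Real.exp (δr * F.d₀)) hα1 F.a₀_nonneg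
      F.Cq_nonneg F.M₂_nonneg hSb hSb2 (Real.exp_nonneg _)
    have hsum := add_le_add hcv
      (le_refl (2 * (Fintype.card κ : ℝ) * (2 * (1 : ℝ) ^ 2 * F.M₂ * (∑ j, ‖b j‖) * Real.sqrt ((1 * Fintype.card ι : ℕ) : ℝ) *
        Real.exp (δr * F.d₀))))
    have h1 := mul_le_mul_of_nonneg_left hsum hpre0
    have h2 : F.cL * B₀ * F.Λf δr (1 / 100) * B6.c1 (F.d261 δr) δr (1 / 100) *
        (cVL2 (Fintype.card κ) (Fintype.card ι) 1 1 F.a₀ F.Cq F.M₂ (∑ j, ‖b j‖) (Real.sqrt (∑ j, ‖b j‖ ^ 2))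
            (Real.exp (δr * F.d₀)) +
          2 * Fintype.card κ * (2 * (1 : ℝ) ^ 2 * F.M₂ * (∑ j, ‖b j‖) * Real.sqrt ((1 * Fintype.card ι : ℕ) : ℝ) *
            Real.exp (δr * F.d₀))) * α₁ ≤
        F.cL * B₀ * F.Λf δr (1 / 100) * B6.c1 (F.d261 δr) δr (1 / 100) *
        (cVL2 (Fintype.card κ) (Fintype.card ι) 1 1 F.a₀ F.Cq F.M₂ (∑ j, ‖b j‖) (Real.sqrt (∑ j, ‖b j‖ ^ 2))
            (Real.exp (δr * F.d₀)) +
          2 * Fintype.card κ * (2 * (1 : ℝ) ^ 2 * F.M₂ * (∑ j, ‖b j‖) * Real.sqrt ((1 * Fintype.card ι : ℕ) : ℝ) *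
            Real.exp (δr * F.d₀))) * 1 :=
      mul_le_mul_of_nonneg_left hα1 (mul_nonneg hpre0 (add_nonneg (le_trans hcV0 hcv) hK0))
    have h3 := mul_le_mul_of_nonneg_right h1 hα₁.le
    linarith
  have hXM' : HasL2Majorant (g := toB6 (geo i) (F.Rr i) (F.Hp i)) (fun p : S i × ι => F.blk i p.1)
      (conj b (diffLetter (F.T i) (F.coord i U) ((((geo i).eta : ℂ))⁻¹) k) * F.Gop i U *
        conj b (vPrimeConc (F.T i) (F.coord i U) (geo i).eta (F.expA i U U') (F.blk i) (F.kQ i U) (F.kF i U U')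
          (F.sQ i U) (F.sF i U U') (F.cfun i)))
      (fun a a' => θ * ((geo i).len a)⁻¹ * Real.exp (-(49 / 50 * δr * (geo i).dist a a'))) := by
    refine hasL2Majorant_mono (g := toB6 (geo i) (F.Rr i) (F.Hp i)) _ hXM fun a a' => le_of_eq ?_
    rw [hθ]
  -- the right entry at this member and the composition
  have hRY := HR i α₀ U hM0 hα₀ hMa hU hE hL2 α₁ U' hα₁ haR' hU' l
  rw [hG] at hRY
  have h365 := eq365_first_of_inverse hGΔ hinv1
  have hrR : rateR δr + (1 / 100 + 1 / 100) * δr ≤ 49 / 50 * δr := by rw [rateR]; nlinarith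
  have hρ0 : 0 ≤ rateR δr := (rateR_pos hδr).le
  have h := hasL2Majorant_mixedEntry_gpExt (R := F.Rr i) (H := F.Hp i) (fun p : S i × ι => F.blk i p.1) (F.d261 δr)
    δr (49 / 50 * δr) (1 / 100) (1 / 100) (rateR δr) (F.Λf δr (1 / 100)) θ (F.cL * B₀) B' hθ0 hBL.le hB' hΛ0 hρ0
    (by norm_num) (by norm_num) hδr.le hrR (F.dist_nonneg i) (F.triangle i) (F.len_pos i) h261β hT1 h365 (r4ρ l) hXM' hRY
  rw [← hG] at h
  refine hasL2Majorant_mono (g := toB6 (geo i) (F.Rr i) (F.Hp i)) _ h fun a a' => ?_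
  have hcoef : F.cL * B₀ + θ * B' * F.Λf δr (1 / 100) * B6.c1 (F.d261 δr) δr (1 / 100) ≤
      F.cL * B₀ + Θ * B' * F.Λf δr (1 / 100) * B6.c1 (F.d261 δr) δr (1 / 100) := by
    have h1 : θ * (B' * F.Λf δr (1 / 100) * B6.c1 (F.d261 δr) δr (1 / 100)) ≤
        Θ * (B' * F.Λf δr (1 / 100) * B6.c1 (F.d261 δr) δr (1 / 100)) :=
      mul_le_mul_of_nonneg_right hθΘ (by positivity)
    have e1 : θ * B' * F.Λf δr (1 / 100) * B6.c1 (F.d261 δr) δr (1 / 100) =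
        θ * (B' * F.Λf δr (1 / 100) * B6.c1 (F.d261 δr) δr (1 / 100)) := by ring
    have e2 : Θ * B' * F.Λf δr (1 / 100) * B6.c1 (F.d261 δr) δr (1 / 100) =
        Θ * (B' * F.Λf δr (1 / 100) * B6.c1 (F.d261 δr) δr (1 / 100)) := by ring
    rw [e1, e2]
    linarith
  exact mul_le_mul_of_nonneg_right (mul_le_mul_of_nonneg_right hcoef zero_le_one) (Real.exp_nonneg _)

/-- ★★ **THE (3.46)₄-STEP OF SECT. B FOR G′(U′U) (the MIXED member `‖h∇_UG′(U′U)∇*_Uλ‖`), INHABITED AT THE LETTERS, KERNEL-FREE**: every `L2Frame₂` with the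
`L²` READINGS of members 2 and 4 at U (`readL2_2`, `readL2_4`) and the WRITING of the mixed member at U′U (`writeL2_4`: block-ℓ² majorants `B·e^{−ρd}` of
every `∇_kG′(U′U)∇♯_l`, letters at the real U ⇒ the member n = 4 of the family at U′U with `(wL B ρ, wLδ ρ)`) inhabits
`B9SectBStepWhole.StepL2nPos d c35 geo bg Gp GA Cinv Gp 4` (output at `rateR (rate δ₀)`) — the fourth of the fifteen displayed member-steps of
`B9SectBStepFrameV2.SectBFrame₂`; which printed quantity member 4 IS remains the instance's choice (the writing is a hypothesis).
[cite: Balaban1985BackgroundPropagators, Thm 3.4 p.400 + Thm 3.1 (3.46) p.398 + p.398 (remarks) + (3.60)–(3.65) p.402 + p.403 l.1–9; Balaban1984PropagatorsII, Prop. 2.6 (2.140)–(2.141) p.247 + Lemma 2.1 p.234] -/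
theorem stepL2nPos_four_of_l2Frame₂ (F : L2Frame₂ c35 geo bg Gp b κ S)
    (readL2_2 : ∀ i (α₀ : ℝ) (U : (bg i).Cfg) (B₀ δ : ℝ), F.MInv ≤ (geo i).M → 0 < α₀ → (geo i).M * α₀ ≤ F.aInv →
      (bg i).Reg335 c35 α₀ U → 0 < B₀ → 0 < δ → L2Block (Gp i) B₀ δ U →
      ∀ k : κ ⊕ κ, HasL2Majorant (g := toB6 (geo i) (F.Rr i) (F.Hp i)) (fun p : S i × ι => F.blk i p.1)
        (F.Gop i U * conj b (diffLetter (F.T i) (F.coord i U) ((((geo i).eta : ℂ))⁻¹) k))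
        (fun a a' => F.cL * B₀ * (geo i).len a * Real.exp (-(δ * (geo i).dist a a'))))
    (readL2_4 : ∀ i (α₀ : ℝ) (U : (bg i).Cfg) (B₀ δ : ℝ), F.MInv ≤ (geo i).M → 0 < α₀ → (geo i).M * α₀ ≤ F.aInv →
      (bg i).Reg335 c35 α₀ U → 0 < B₀ → 0 < δ → L2Block (Gp i) B₀ δ U →
      ∀ k l : κ ⊕ κ, HasL2Majorant (g := toB6 (geo i) (F.Rr i) (F.Hp i)) (fun p : S i × ι => F.blk i p.1)
        (conj b (diffLetter (F.T i) (F.coord i U) ((((geo i).eta : ℂ))⁻¹) k) * F.Gop i U *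
          conj b (diffLetter (F.T i) (F.coord i U) ((((geo i).eta : ℂ))⁻¹) l))
        (fun a a' => F.cL * B₀ * 1 * Real.exp (-(δ * (geo i).dist a a'))))
    (writeL2_4 : ∀ i (U U' : (bg i).Cfg) (α₁ B δ : ℝ), 0 < α₁ → α₁ ≤ F.aW → (bg i).Cplx337 α₁ U U' → 0 ≤ B → 0 < δ →
      (∀ k l : κ ⊕ κ, HasL2Majorant (g := toB6 (geo i) (F.Rr i) (F.Hp i)) (fun p : S i × ι => F.blk i p.1)
          (conj b (diffLetter (F.T i) (F.coord i U) ((((geo i).eta : ℂ))⁻¹) k) * F.Gop i ((bg i).mul U' U) *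
            conj b (diffLetter (F.T i) (F.coord i U) ((((geo i).eta : ℂ))⁻¹) l))
          (fun a a' => B * 1 * Real.exp (-(δ * (geo i).dist a a')))) →
      ∀ (lam : (geo i).Loc) (h : (geo i).Cut) (y y' : (geo i).Site), (geo i).cutIn h y → (geo i).suppIn lam y' →
        (Gp i).l2 4 ((bg i).mul U' U) lam h ≤
          F.wL B δ * B9.pref6 ((geo i).len y) 4 * (geo i).cutSup h * Real.exp (-(F.wLδ δ * (geo i).dist y y')) *
            (geo i).l2Norm lam)
    (GA : ∀ i, B9.KernelFamily (geo i) (bg i)) (Cinv : ∀ i, B9.SiteKernel (geo i) (bg i)) :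
    StepL2nPos d c35 geo bg Gp GA Cinv Gp 4 := by
  intro B₀ δ₀ Bβ Bε Bεβ B₁ δ₁ hB₀ hδ₀ _ _
  obtain ⟨a₁, ha₁, B, hB, Hc⟩ := l2mixedEntries_ext_of_l2Frame₂ F readL2_2 readL2_4 hB₀ hδ₀
  have hρ' : 0 < rateR (F.rate δ₀) := rateR_pos (F.rate_pos hδ₀)
  refine ⟨F.Mthr (F.rate δ₀), min a₁ F.aW, F.aInv, (F.wL B (rateR (F.rate δ₀)), F.wLδ (rateR (F.rate δ₀))), F.Mthr_pos _,
    lt_min ha₁ F.aW_pos, F.aInv_pos, ⟨F.wL_pos B _ hB hρ', F.wLδ_pos _ hρ'⟩, ?_⟩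
  intro i hM0 α₀ hα₀ hMa U hU hT α₁ hα₁ ha U' hU' lam h y y' hcut hs
  have e4 := Hc i α₀ U hM0 hα₀ hMa hU hT.1.1.1 hT.1.1.2.1 α₁ U' hα₁ (le_trans ha (min_le_left _ _)) hU'
  exact writeL2_4 i U U' α₁ B _ hα₁ (le_trans ha (min_le_right _ _)) hU' hB hρ' e4 lam h y y' hcut hs

end Literature.MathematicalPhysics.QuantumFieldTheory.Balaban1983to89.B9SectBL2StepAtLettersV2Mixed
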